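import Summits.QuantumFields.YangMills.Theorems.FluctuationComparisonRegPrIntLWregAssembly
import Summits.QuantumFields.YangMills.Theorems.FluctuationComparisonRegPrIntLWregChartVol
import Summits.QuantumFields.YangMills.Theorems.FluctuationComparisonRegPrIntLWregChartEdge
import Summits.QuantumFields.YangMills.Theorems.FluctuationComparisonRegPrIntLWregChartLevelNear
import Summits.QuantumFields.YangMills.Theorems.FluctuationComparisonRegPrIntLWregChartCharge
import HarnessLib

/-!
# `FluctuationComparisonRegPrIntLWreg` — THE ORGAN WREG `WindowRegularity` OF THE DECIDING CRUX `FluctuationComparisonRegPrIntL` (stmt-QuantumFields-20520), BY NAME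
# (F6 = the KNIT of the WREG port; `Lines/wreg_chart.lean` v20 §5 ll. 2761–2806 VERBATIM with the four chart-free entries supplied by their Theorems twins)

Cell `ym3-torus` (HUMAN RULING D-0037: YM₃ on T³ is ladder rung R3 — NOT d = 4, NOT infinite volume, NOT a mass gap, NOT the Clay problem); width seat
`ym-ust-20520-w3` gen 13; `--supports stmt-QuantumFields-20520 --as helper` (count-neutral; `WindowRegularity` is NOT a registered stub of 20520 — helper only).
★★OWNER ym3-torus-plan g31 WORD 31 (A) «F6 `…Wreg` (the KNIT) := w3-20520 g13»; port map: ideator ym-r3-idea-1 g18 `Lines/wreg_chart_port.md` @7bd96d90.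
THEOREMS ONLY (0 `def`, 0 `sorry`, default heartbeats, no `attribute` surgery); term-mode knit of NAMES — it proves nothing new.

THE PORT (dependency order, one pen per file): F1 `…WregChain` (px13 g8) → F2 `…WregFibredChart` (px11 g8) → F3 `…WregGlue` (px7 g8: `def heightDensityCan`,
`def WindowRegularity`, `structure WindowChart`, `windowRegularity_of_chart`) → F4 `…WregInterior` (px17 g6: `def ChartVolT3 ∕ EdgeFlat ∕ LevelFlat ∕ ChartCharge ∕
LevelFlatNear`, `windowFibreInterior_holds`, `levelFlat_of_near`) → F5 `…WregAssembly` (w4-20520 g14: ★`windowChartsExist_of_flat`) → F6 (this file).  The four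
chart-free entries: VOL ✓p726709 `…WregChartVol.chartVolT3_holds` (px17 g6), EDGE ✓p729403 `…WregChartEdge.edgeFlat_of_chainEqns` (px17 g6), LEVEL-NEAR ✓p729055
`…WregChartLevelNear.levelFlatNear_of_chain` (w4-20520 g14), CHARGE ✓p729224 `…WregChartCharge.chartCharge_holds` (w3-20520 g13).

HONEST FRAMING.  WREG (the `θ_J(γ)`-window lies in `regSet` of every `γ′`-weighted small-field fibre density, and the canonical version is positive there) is ONE
organ of S2β `FluctuationPartSmall`; it feeds `stub_windowRegularity` of LINE g18-1 `Lines/semiclassical_s2beta.lean` and of `Lines/polymer_norm_s2beta.lean` BY NAME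
(their local `def WindowRegularity` is text-identical); EXW ∕ GAP ∕ LAPLACE ∕ H4ᶜ ∕ LFR ∕ SFN, the package `Lines/runpair_organ.lean`'s seven stubs, the crux
`FluctuationComparisonRegPrIntL` (stmt-QuantumFields-20520) and every summit statement are NOT proved here; YM₃ on T³ = rung R3 — NOT d = 4, NOT infinite volume,
NOT a mass gap, NOT Clay; the Yang–Mills mass gap is NOT proved.

References: T. Bałaban, CMP 109 (1987) 249–301 [Balaban1987RG1] ((0.4) p.253, (2.9)–(2.10) pp.266–267); CMP 102 (1985) 255–275 [Balaban1985UV3] ((2) p.256, (7) p.257,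
(28)–(31) p.263); CMP 98 (1985) 17–51 [Balaban1985Averaging] ((10) p.19).
-/

noncomputable section

open MeasureTheory Filter Topology Set
open scoped ENNReal NNReal
open Literature.MathematicalPhysics.QuantumFieldTheory.Balaban1983to89
open Literature.MathematicalPhysics.QuantumFieldTheory.Balaban1983to89.T3ContinuumYM3Torus
open Literature.MathematicalPhysics.QuantumFieldTheory.Balaban1983to89.T3NestedUnitLaws
open Literature.MathematicalPhysics.QuantumFieldTheory.Balaban1983to89.T3UnitLawDensityEML
open Literature.MathematicalPhysics.QuantumFieldTheory.Balaban1983to89.T3UnitScaleTilt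
open Literature.MathematicalPhysics.QuantumFieldTheory.Balaban1983to89.T3TiltDescent
open Literature.MathematicalPhysics.QuantumFieldTheory.Balaban1983to89.T3PrintedRegularMinimiser
open Literature.MathematicalPhysics.QuantumFieldTheory.Balaban1983to89.T3ConstrainedMinimiser (fibre)
open Literature.MathematicalPhysics.QuantumFieldTheory.Balaban1983to89.T3LevelShift
open Literature.MathematicalPhysics.QuantumFieldTheory.Balaban1983to89.T3SmallLiftHistory
open Literature.MathematicalPhysics.QuantumFieldTheory.Balaban1983to89.T3Thresholds
open Literature.MathematicalPhysics.QuantumFieldTheory.Balaban1983to89.Missing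
open Literature.MathematicalPhysics.QuantumFieldTheory.Balaban1983to89.T4Continuum
open scoped Literature.MathematicalPhysics.QuantumFieldTheory.Balaban1983to89.T3OrbitAverage

namespace Summit.QuantumFields.YangMills.Theorems.FluctuationComparisonRegPrIntLWreg

open Summit.QuantumFields.YangMills.Theorems.FluctuationComparisonRegPrIntLWregChain
open Summit.QuantumFields.YangMills.Theorems.FluctuationComparisonRegPrIntLWregFibredChart
open Summit.QuantumFields.YangMills.Theorems.FluctuationComparisonRegPrIntLWregGlue
open Summit.QuantumFields.YangMills.Theorems.FluctuationComparisonRegPrIntLWregInterior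
open Summit.QuantumFields.YangMills.Theorems.FluctuationComparisonRegPrIntLWregAssembly

/-! ## The four chart-free entries BY NAME and the knit -/

/-- **VOL** by name — px17 g6 ✓p726709 `…WregChartVol.chartVolT3_holds` (typed against the stub text with `ChainVol` ∕ `centralWindowSet` unfolded; `δ`-equal).
[cite: Balaban1987RG1, (0.4) p.253 and (2.10) p.267] -/
theorem chartVol : ChartVolT3 :=
  Summit.QuantumFields.YangMills.Theorems.FluctuationComparisonRegPrIntLWregChartVol.chartVolT3_holds

/-- **EDGE** by name — px17 g6 ✓p729403 `…WregChartEdge.edgeFlat_of_chainEqns` at the concrete `iterCentralBond` ∕ `chainMap ℰp` ∕ `chainWindow α` (five `rfl`s).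
[cite: Balaban1987RG1, (0.4) p.253 and (2.9) p.266] -/
theorem edgeFlat : EdgeFlat :=
  Summit.QuantumFields.YangMills.Theorems.FluctuationComparisonRegPrIntLWregChartEdge.edgeFlat_of_chainEqns
    (fun P n => iterCentralBond (P := P) n) (fun P n => chainMap (P := P) ℰp n) (fun P α n => chainWindow (P := P) (N := 2) α n)
    (fun _ _ => rfl) (fun _ _ _ => rfl) (fun _ _ _ _ _ => rfl) (fun _ _ _ _ => rfl) (fun _ _ _ _ _ => rfl)

/-- **LEVEL-NEAR** by name — w4-20520 g14 ✓p729055 `…WregChartLevelNear.levelFlatNear_of_chain`, its six chain hypotheses discharged by the ported §0 letters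
(`chainWindow_succ`, `chainMap_injOn`, `chain_imageNull`, `chainMap_extend`, `chainWindow_extend`, `measurableSet_chainWindow₂`, `measurable_chainMap₂`).
[cite: Balaban1985UV3, (7) p.257 and (28)-(31) p.263] -/
theorem levelFlatNear : LevelFlatNear := by
  intro F K n hn α hα0 hα24 hα64 hαL hgap t ht W
  have hαδ : α < ExpMeanLog.deltaSU (Fin 2) := by linarith
  exact Summit.QuantumFields.YangMills.Theorems.FluctuationComparisonRegPrIntLWregChartLevelNear.levelFlatNear_of_chain (F.P K) n hn α t
    ht W iterCentralBond (fun _ => rfl) (fun _ _ => rfl) (chainMap ℰp) (fun _ _ _ _ => rfl) (chainWindow (N := 2) α) (fun _ _ => rfl)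
    (fun k U c => chainWindow_succ α k U c) (fun U c => chainMap_injOn hα0.le hα24 hαδ hgap hn U c)
    (fun U c A hA hA0 => chain_imageNull hα0.le hα24 hα64 hαL hgap hn U c hA hA0) (fun g U c => chainMap_extend ℰp hn g U c)
    (fun g U c => chainWindow_extend α hn g U c) (fun c => measurableSet_chainWindow₂ α n c) (fun c => measurable_chainMap₂ n c)

/-- **LEVEL = LEVEL-NEAR + LEVEL-FAR** (`levelFlat_of_near`, ported §4g). [cite: Balaban1985UV3, (7) p.257] -/
theorem levelFlat : LevelFlat := levelFlat_of_near levelFlatNear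

/-- **CHARGE** by name — w3-20520 g13 ✓p729224 `…WregChartCharge.chartCharge_holds` at the concrete `iterCentralBond` (two `rfl`s).
[cite: Balaban1987RG1, (2.10) p.267; Balaban1985Averaging, (10) p.19] -/
theorem chartCharge : ChartCharge :=
  Summit.QuantumFields.YangMills.Theorems.FluctuationComparisonRegPrIntLWregChartCharge.chartCharge_holds
    (fun P n => iterCentralBond (P := P) n) (fun _ _ => rfl) (fun _ _ _ => rfl)

/-- **CHART** from the four entries (the PROVED assembly `windowChartsExist_of_flat`, ported §4e). [cite: Balaban1987RG1, (2.10) p.267] -/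
theorem windowCharts : WindowChartsExist :=
  windowChartsExist_of_flat chartVol edgeFlat levelFlat chartCharge

/-- ★★★ **THE ORGAN WREG `WindowRegularity` OF THE DECIDING CRUX `FluctuationComparisonRegPrIntL` (stmt-QuantumFields-20520), BY NAME**: the `θ_J(γ)`-window lies in
`regSet` of every `γ′`-weighted small-field fibre density and the canonical version is positive there (`windowRegularity_of_chart` ∘ `windowChartsExist_of_flat` on
VOL ∕ EDGE ∕ LEVEL ∕ CHARGE, and the proved INTERIOR `windowFibreInterior_holds`).  WREG is ONE organ of S2β (it feeds LINE g18-1's `stub_windowRegularity` and the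
polymer-norm line's, BY NAME after this file); it is NOT the crux and NOT a registered stub; nothing of EXW ∕ GAP ∕ LAPLACE ∕ H4ᶜ ∕ LFR ∕ S2β ∕ the crux is
proved; no summit statement is proved; YM₃ on T³ = rung R3 — NOT d = 4, NOT infinite volume, NOT a mass gap, NOT Clay.
[cite: Balaban1987RG1, (2.10) p.267; Balaban1985UV3, (2) p.256 and (7) p.257; Balaban1985Averaging, (10) p.19] -/
theorem windowRegularity : WindowRegularity :=
  windowRegularity_of_chart windowCharts windowFibreInterior_holds

/-- info: 'Summit.QuantumFields.YangMills.Theorems.FluctuationComparisonRegPrIntLWreg.windowRegularity' depends on axioms: [propext,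
 Classical.choice,
 Quot.sound] -/
#guard_msgs in
#print axioms windowRegularity

end Summit.QuantumFields.YangMills.Theorems.FluctuationComparisonRegPrIntLWreg

end
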